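import Summits.CriticalPhenomena.Ising3DConformalLimit.Theses.LatticeSDPCertificates
import Summits.CriticalPhenomena.Ising3DConformalLimit.Theorems.EnergyNotSigmaSquaredGapForcesFarMergingSandwichFarMergingSpins
import Summits.CriticalPhenomena.Ising3DConformalLimit.Theorems.EnergyNotSigmaSquaredGapForcesFarMergingSandwichFourToTwoAuxDictionary
import Summits.CriticalPhenomena.Ising3DConformalLimit.Theorems.LatticeSDPCertificatesWindowForcesU4WindowDuplicatedMeeting
import Summits.CriticalPhenomena.Ising3DConformalLimit.Theorems.FKParityRobustnessFarMergingGivesU4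
import HarnessLib

/-!
# Crux `WindowForcesU4` (stmt-CriticalPhenomena-5505), line `birth`/`registered`: what the open stub B
# (`stub_windowLatticeMeetingRobustness`) IS, given the landed stub A

Stub B of the checked skeleton `Cruxes/WindowForcesU4/Lines/birth.lean` reads
`WindowBelowHalf → MeetingRobustnessShape`, where (written out in every statement below; no definition is introduced)
`MeetingRobustnessShape ≡ ∃ y inj, ∃ c > 0, ∃ᶠ L, ∃ᶠ n, c · meet n (L•y) ≤ merge n (L•y)`
(lattice, limit-free `meet → merge` comparison along ONE shape). With stub A now a theorem
(`windowDuplicatedMeeting`: WINDOW ⇒ `meet n (L•y) ≥ c(y) > 0` for all large `L`, eventually in `n`),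
this file records, sorry-free:

* `meetingRobustnessShape_of_farMergeIO` : `FarMergeIO → MeetingRobustnessShape` (no WINDOW needed:
  `meet ≤ 1`, `meet_le_one`);
* `farMergeIO_of_meetingRobustnessShape` : `WindowBelowHalf → MeetingRobustnessShape → FarMergeIO`
  (stub A); hence `meetingRobustnessShape_iff_farMergeIO` : under WINDOW, `MeetingRobustnessShape ↔ FarMergeIO`
  — stub B is EXACTLY "WINDOW ⇒ far two-current merging infinitely often along one shape", the currency
  `FarMergeIO` of the sibling crux `GapForcesFarMerging` (stmt-4468, `…GapForcesFarMergingSandwichDefs`), whose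
  own open stub `stub_fourToTwoMerging : FarHitIO → FarMergeIO` has the same consequent;
* `windowForcesU4_of_window_farMergeIO` : `(WindowBelowHalf → FarMergeIO) → WindowForcesU4` (the crux BY NAME
  from the WINDOW-conditional far merging, through the landed `stub_farMergingSpins : FarMergeIO → FarMerging`
  and item stmt-4471 `farMergingGivesU4_proof`), and `windowForcesU4_of_farMergeIO : FarMergeIO → WindowForcesU4`.

So the residual content of the crux after this line's wave 1 is the single lattice statement `FarMergeIO`
(or its WINDOW-conditional form): positive two-current merging probability
`P^{Ly₀Ly₁,Ly₂Ly₃}_{Λ_n}[Ly₀ ↔ Ly₂ in n₁+n₂] ≥ c` at macroscopic separation along infinitely many dilations of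
one injective shape — Aizenman's 1982 criterion for non-Gaussianity, open on `ℤ³`.

References: M. Aizenman, Comm. Math. Phys. 86 (1982) §5 Prop. 5.3; M. Aizenman, H. Duminil-Copin, Ann. of
Math. 194 (2021) = arXiv:1912.07973, (3.11), (3.13).
-/

noncomputable section

namespace Summit.CriticalPhenomena.Ising3DConformalLimit.LatticeSDPCertificatesWindowForcesU4

open Filter Topology
open Literature.Probability.LatticeModels Literature.Probability.Percolation
open Summit.CriticalPhenomena.Ising3DConformalLimit.Theses.LatticeSDPCertificates (WindowForcesU4 WindowBelowHalf)
open Summit.CriticalPhenomena.Ising3DConformalLimit.GapForcesFarMergingSandwich (meet merge FarMergeIO FarMerging)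
open Summit.CriticalPhenomena.Ising3DConformalLimit.EnergyNotSigmaSquaredGapForcesFarMergingSandwich
  (stub_farMergingSpins)
open Summit.CriticalPhenomena.Ising3DConformalLimit.EnergyNotSigmaSquaredGapForcesFarMergingSandwich.FourToTwoProof
  (meet_le_one)

/-- `FarMergeIO → MeetingRobustnessShape`: if merging is `≥ c` then `c · meet ≤ c ≤ merge` (`meet ≤ 1`). [folklore] -/
theorem meetingRobustnessShape_of_farMergeIO (h : FarMergeIO) :
    (∃ y : Fin 4 → Site 3, Function.Injective y ∧
      ∃ c : ℝ, 0 < c ∧ ∃ᶠ L : ℕ in atTop, ∃ᶠ n : ℕ in atTop,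
        c * meet n (fun i => (L : ℤ) • y i) ≤ merge n (fun i => (L : ℤ) • y i)) := by
  obtain ⟨c, hc, y, hy, hL⟩ := h
  refine ⟨y, hy, c, hc, ?_⟩
  refine Filter.frequently_atTop.2 fun L₀ => ?_
  obtain ⟨L, hL₀, hn⟩ := hL L₀
  refine ⟨L, hL₀, hn.mono fun n hcn => ?_⟩
  calc c * meet n (fun i => (L : ℤ) • y i) ≤ c * 1 :=
        mul_le_mul_of_nonneg_left (meet_le_one n _) hc.le
    _ ≤ merge n (fun i => (L : ℤ) • y i) := by rw [mul_one]; exact hcn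

/-- `WindowBelowHalf → MeetingRobustnessShape → FarMergeIO`: under WINDOW duplicated meeting is `≥ c₁(y) > 0` for all
large `L`, eventually in `n` (`windowDuplicatedMeeting`, stub A of the line), so `c · meet ≤ merge` frequently gives
`merge ≥ c c₁` frequently. [cite: AizenmanDuminilCopinAnnals2021, §4.2 Lemma 4.4] -/
theorem farMergeIO_of_meetingRobustnessShape (hW : WindowBelowHalf)
    (h : (∃ y : Fin 4 → Site 3, Function.Injective y ∧
      ∃ c : ℝ, 0 < c ∧ ∃ᶠ L : ℕ in atTop, ∃ᶠ n : ℕ in atTop,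
        c * meet n (fun i => (L : ℤ) • y i) ≤ merge n (fun i => (L : ℤ) • y i))) :
    FarMergeIO := by
  obtain ⟨y, hy, c, hc, hfreq⟩ := h
  obtain ⟨c₁, hc₁, hev⟩ := windowDuplicatedMeeting hW y hy
  have hmerge : ∃ᶠ L : ℕ in atTop, ∃ᶠ n : ℕ in atTop,
      c * c₁ ≤ merge n (fun i => (L : ℤ) • y i) := by
    refine (hfreq.and_eventually hev).mono ?_
    rintro L ⟨hL, hL'⟩
    refine (hL.and_eventually hL').mono ?_
    rintro n ⟨hn, hn'⟩
    exact (mul_le_mul_of_nonneg_left hn' hc.le).trans hn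
  refine ⟨c * c₁, mul_pos hc hc₁, y, hy, fun L₀ => ?_⟩
  obtain ⟨L, hL₀, hL⟩ := ((eventually_ge_atTop L₀).and_frequently hmerge).exists
  exact ⟨L, hL₀, hL⟩

/-- **Under WINDOW, stub B's consequent is exactly far two-current merging i.o. along one shape.** [folklore] -/
theorem meetingRobustnessShape_iff_farMergeIO (hW : WindowBelowHalf) :
    (∃ y : Fin 4 → Site 3, Function.Injective y ∧
      ∃ c : ℝ, 0 < c ∧ ∃ᶠ L : ℕ in atTop, ∃ᶠ n : ℕ in atTop,
        c * meet n (fun i => (L : ℤ) • y i) ≤ merge n (fun i => (L : ℤ) • y i)) ↔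
      FarMergeIO :=
  ⟨farMergeIO_of_meetingRobustnessShape hW, meetingRobustnessShape_of_farMergeIO⟩

/-- **The crux from WINDOW-conditional far merging**: `(WindowBelowHalf → FarMergeIO) → WindowForcesU4` — far merging
i.o. along one shape is Aizenman's far merging of the lattice Ursell function (`stub_farMergingSpins`, landed), which
item stmt-4471 (`farMergingGivesU4_proof`, landed) transfers to `HasNontrivialU4 S` for every non-degenerate pointwise
scaling limit. [cite: Aizenman1982, Prop. 5.3] [cite: AizenmanDuminilCopinAnnals2021, eq. (3.11)] -/
theorem windowForcesU4_of_window_farMergeIO : (WindowBelowHalf → FarMergeIO) → WindowForcesU4 := by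
  intro h hW ρ S hρ hlim hnd
  obtain ⟨c, hc, x, hx, hfar⟩ := stub_farMergingSpins (h hW)
  have hF := Summit.CriticalPhenomena.Ising3DConformalLimit.FKParityRobustnessFarMergingGivesU4.farMergingGivesU4_proof
  unfold Summit.CriticalPhenomena.Ising3DConformalLimit.Theses.FKParityRobustness.FarMergingGivesU4 at hF
  exact hF ⟨c, hc, x, hx, hfar⟩ ρ S hρ hlim hnd

/-- In particular unconditional far merging i.o. (`FarMergeIO`) proves the crux outright. [cite: Aizenman1982, Prop. 5.3] -/
theorem windowForcesU4_of_farMergeIO (h : FarMergeIO) : WindowForcesU4 :=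
  windowForcesU4_of_window_farMergeIO fun _ => h

/-- The crux from stub B's statement alone (stub A being a theorem): `(WindowBelowHalf → MeetingRobustnessShape) →
WindowForcesU4`. [cite: Aizenman1982, Prop. 5.3] -/
theorem windowForcesU4_of_window_meetingRobustnessShape
    (h : WindowBelowHalf → (∃ y : Fin 4 → Site 3, Function.Injective y ∧
      ∃ c : ℝ, 0 < c ∧ ∃ᶠ L : ℕ in atTop, ∃ᶠ n : ℕ in atTop,
        c * meet n (fun i => (L : ℤ) • y i) ≤ merge n (fun i => (L : ℤ) • y i))) :
    WindowForcesU4 :=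
  windowForcesU4_of_window_farMergeIO fun hW => farMergeIO_of_meetingRobustnessShape hW (h hW)

end Summit.CriticalPhenomena.Ising3DConformalLimit.LatticeSDPCertificatesWindowForcesU4

end
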